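import Mathlib
import HarnessLib
import Literature.Probability.RandomMatrix.MilzStrunzXStates

/-!
# Proof of the Milz–Strunz X-state separability probability `2/5`

Discharges the named fact `MilzStrunz2014_xState_separability_probability` of
`MilzStrunzXStates.lean`:
`theorem MilzStrunz2014_xState_separability_probability_holds : 5 * volume xStatePPTBody =
2 * volume xStateBody`, i.e. the Hilbert–Schmidt (= Lebesgue, in the entry chart
`(a, b, c, Re w, Im w, Re z, Im z) ∈ ℝ⁷`, `d = 1 − a − b − c`) separability probability of
two-qubit X-states is `2/5` — S. Milz, W. T. Strunz, *Volumes of conditioned bipartite state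
spaces*, J. Phys. A 48 (2015) 035306 [MilzStrunz2014], §5 (`p_sep^{(X)}(r) = 2/5`) with
Appendix A (`V_euclid^{(X)}`) and Appendix B (`V_euclid,sep^{(X)}`).

## The published proof and how it is mirrored

Milz–Strunz (App. A) observe that the two positivity inequalities of an X-state are two *disc*
conditions, `x² + y² ≤ r²`, `X² + Y² ≤ R²`, whose squared radii are products of the diagonal
data (`r² = (1+Z)(1−z)`, `R² = (1−Z)(1+z)` after conditioning on the reduced state `a₃` and
rescaling); integrating the two discs out gives `π r² · π R²`, and the remaining integral
factorises. App. B: the partial transpose swaps the two radii, so PPT (= separable,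
Peres–Horodecki) replaces both squared radii by `min(r², R²)`; "`r² < R² ⇔ Z < z`" splits the
remaining integral into two polynomial pieces, `V_sep/V = (4/45)/(2/9) = 2/5` for every `a₃`.

In the entry chart the same steps read (with `Δ = {a, b, c, d ≥ 0}` the simplex):
* `volume_eq_lintegral7`: Tonelli (`lmarginal` peeling) writes a volume in `ℝ⁷` as seven
  iterated one-dimensional Lebesgue integrals;
* `lintegral_disc`: `∫∫ 𝟙[p² + q² ≤ K] dp dq = πK` (via `∫ 2√(K − p²) = πK`, reduced to
  Mathlib's `integral_sqrt_one_sub_sq`), used for the two discs `|w|² ≤ ad`, `|z|² ≤ bc`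
  (X-states) resp. `|w|², |z|² ≤ m := min(ad, bc)` (PPT X-states);
* X-states: `vol = π² ∫_Δ abcd = π²/5040` by three polynomial layers
  (`layerC_X`, `layerB_X`, `layerA_X`; Milz–Strunz eq. `V^{(X)}_HS = π²/5040`);
* PPT X-states: `vol = π² ∫_Δ m²`; the `c`-layer `∫₀^τ min(a(τ−c), bc)² dc =
  τ³a²b²/(3(a+b)²)` (`integral_layerC_P`, the branch switch at `c = aτ/(a+b)` is the paper's
  "`Z < z`"), then the paper's conditioning variable `σ = a + b = (1 + a₃)/2` is introduced by
  the shear `b = σ − a` (translation invariance) and Tonelli, after which the `a`-layer is the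
  Beta integral `∫₀^σ a²(σ−a)² = σ⁵/30` and the `σ`-layer `∫₀¹ (1−σ)³σ³/90 = 1/12600`
  (`layerAB_P`), so `vol = π²/12600`;
* `5 · π²/12600 = 2 · π²/5040`.

All helper lemmas live in the sub-namespace `MilzStrunzXStates` and are proved here; no new
named facts are introduced (D-0026).

## References

* [MilzStrunz2014] S. Milz, W. T. Strunz, J. Phys. A 48 (2015) 035306, §5, App. A, App. B.
  arXiv:1408.3666.
-/

noncomputable section

open MeasureTheory Set Real
open scoped ENNReal

namespace Literature.Probability.RandomMatrix

namespace MilzStrunzXStates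

/-! ### Tonelli: a volume in `ℝ⁷` as seven iterated integrals -/

/-- Seven successive coordinate updates of a vector in `ℝ⁷` give the literal vector. [folklore] -/
theorem update7_eq (x0 x1 x2 x3 x4 x5 x6 : ℝ) :
    Function.update (Function.update (Function.update (Function.update (Function.update
      (Function.update (Function.update (0 : Fin 7 → ℝ) 0 x0) 1 x1) 2 x2) 3 x3) 4 x4) 5 x5) 6 x6 =
      ![x0, x1, x2, x3, x4, x5, x6] := by
  ext i
  fin_cases i <;> simp

/-- Tonelli in `ℝ⁷`: the Lebesgue measure of a measurable set is the seven-fold iterated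
integral of its indicator. [folklore] -/
theorem volume_eq_lintegral7 {S : Set (Fin 7 → ℝ)} (hS : MeasurableSet S) :
    volume S = ∫⁻ x0, ∫⁻ x1, ∫⁻ x2, ∫⁻ x3, ∫⁻ x4, ∫⁻ x5, ∫⁻ x6 : ℝ,
      S.indicator 1 ![x0, x1, x2, x3, x4, x5, x6] := by
  have hf : Measurable (S.indicator (1 : (Fin 7 → ℝ) → ℝ≥0∞)) := measurable_one.indicator hS
  rw [← lintegral_indicator_one hS, volume_pi, lintegral_eq_lmarginal_univ (0 : Fin 7 → ℝ)]
  have h7 : (Finset.univ : Finset (Fin 7)) =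
      insert 0 (insert 1 (insert 2 (insert 3 (insert 4 (insert 5 {6}))))) := by decide
  have i0 : (0 : Fin 7) ∉ (insert 1 (insert 2 (insert 3 (insert 4 (insert 5 {6})))) :
      Finset (Fin 7)) := by decide
  have i1 : (1 : Fin 7) ∉ (insert 2 (insert 3 (insert 4 (insert 5 {6}))) : Finset (Fin 7)) := by
    decide
  have i2 : (2 : Fin 7) ∉ (insert 3 (insert 4 (insert 5 {6})) : Finset (Fin 7)) := by decide
  have i3 : (3 : Fin 7) ∉ (insert 4 (insert 5 {6}) : Finset (Fin 7)) := by decide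
  have i4 : (4 : Fin 7) ∉ (insert 5 {6} : Finset (Fin 7)) := by decide
  have i5 : (5 : Fin 7) ∉ ({6} : Finset (Fin 7)) := by decide
  rw [h7]
  simp only [lmarginal_insert _ hf i0, lmarginal_insert _ hf i1, lmarginal_insert _ hf i2,
    lmarginal_insert _ hf i3, lmarginal_insert _ hf i4, lmarginal_insert _ hf i5,
    lmarginal_singleton, update7_eq]

/-! ### The two indicators, factorised into simplex part and two discs -/

/-- Indicator of the X-body at a literal vector: simplex conditions times the two disc
conditions `|w|² ≤ ad`, `|z|² ≤ bc`. [folklore] -/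
theorem indicator_xStateBody (a b c p q r s : ℝ) :
    xStateBody.indicator (1 : (Fin 7 → ℝ) → ℝ≥0∞) ![a, b, c, p, q, r, s] =
      (if 0 ≤ a ∧ 0 ≤ b ∧ 0 ≤ c ∧ 0 ≤ 1 - a - b - c then 1 else 0) *
        (if p ^ 2 + q ^ 2 ≤ a * (1 - a - b - c) then 1 else 0) *
        (if r ^ 2 + s ^ 2 ≤ b * c then 1 else 0) := by
  simp only [Set.indicator_apply, xStateBody, Set.mem_setOf_eq, Pi.one_apply,
    ite_zero_mul_ite_zero, mul_one, and_assoc]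
  simp

/-- Indicator of the PPT X-body at a literal vector: simplex conditions times the two disc
conditions with the common squared radius `min(ad, bc)`. [folklore] -/
theorem indicator_xStatePPTBody (a b c p q r s : ℝ) :
    xStatePPTBody.indicator (1 : (Fin 7 → ℝ) → ℝ≥0∞) ![a, b, c, p, q, r, s] =
      (if 0 ≤ a ∧ 0 ≤ b ∧ 0 ≤ c ∧ 0 ≤ 1 - a - b - c then 1 else 0) *
        (if p ^ 2 + q ^ 2 ≤ min (a * (1 - a - b - c)) (b * c) then 1 else 0) *
        (if r ^ 2 + s ^ 2 ≤ min (a * (1 - a - b - c)) (b * c) then 1 else 0) := by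
  simp only [Set.indicator_apply, xStatePPTBody, Set.mem_setOf_eq, Pi.one_apply,
    ite_zero_mul_ite_zero, mul_one, and_assoc, le_min_iff]
  simp only [Matrix.cons_val, and_assoc, and_comm, and_left_comm]

/-! ### One-dimensional pieces -/

/-- `vol {t | t² ≤ L} = 2√L` (also for `L < 0`, both sides `0`). [folklore] -/
theorem lintegral_sq_le (L : ℝ) :
    ∫⁻ t, (if t ^ 2 ≤ L then (1 : ℝ≥0∞) else 0) = ENNReal.ofReal (2 * √L) := by
  by_cases hL : 0 ≤ L
  · have hset : ∀ t : ℝ, (t ^ 2 ≤ L ↔ t ∈ Icc (-√L) (√L)) := fun t => by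
      rw [Real.sq_le hL, Set.mem_Icc]
    simp_rw [hset]
    have hfun : (fun t => if t ∈ Icc (-√L) (√L) then (1 : ℝ≥0∞) else 0) =
        (Icc (-√L) (√L)).indicator 1 := by
      funext t; simp [Set.indicator_apply]
    rw [hfun, lintegral_indicator_one measurableSet_Icc, Real.volume_Icc]
    congr 1; ring
  · push Not at hL
    have h1 : ∀ t : ℝ, ¬ (t ^ 2 ≤ L) := fun t h => by nlinarith [sq_nonneg t]
    have h2 : √L = 0 := Real.sqrt_eq_zero'.mpr hL.le
    simp [h1, h2]

/-- `∫ 2√(K − p²) dp = πK` (area of the disc of radius `√K`; both sides `0` for `K ≤ 0`).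
[folklore] -/
theorem lintegral_sqrt_sub_sq (K : ℝ) :
    ∫⁻ p, ENNReal.ofReal (2 * √(K - p ^ 2)) = ENNReal.ofReal (π * K) := by
  rcases le_or_gt K 0 with hK | hK
  · have h0 : ∀ p : ℝ, √(K - p ^ 2) = 0 := fun p =>
      Real.sqrt_eq_zero'.mpr (by nlinarith [sq_nonneg p])
    have h1 : ENNReal.ofReal (π * K) = 0 :=
      ENNReal.ofReal_eq_zero.mpr (mul_nonpos_of_nonneg_of_nonpos pi_pos.le hK)
    simp [h0, h1]
  · set R := √K with hR
    have hR0 : 0 < R := Real.sqrt_pos.mpr hK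
    have hRK : R ^ 2 = K := Real.sq_sqrt hK.le
    have hsupp : Function.support (fun p : ℝ => ENNReal.ofReal (2 * √(K - p ^ 2))) ⊆
        Icc (-R) R := by
      intro p hp
      rw [Function.mem_support] at hp
      by_contra hp'
      apply hp
      have : K - p ^ 2 ≤ 0 := by
        rw [Set.mem_Icc, not_and_or, not_le, not_le] at hp'
        rcases hp' with h | h <;> nlinarith
      rw [Real.sqrt_eq_zero'.mpr this, mul_zero, ENNReal.ofReal_zero]
    rw [← setLIntegral_eq_of_support_subset hsupp,
      ← ofReal_integral_eq_lintegral_ofReal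
        ((by fun_prop : Continuous fun p : ℝ => 2 * √(K - p ^ 2)).integrableOn_Icc)
        (Filter.Eventually.of_forall fun p => by simp only [Pi.zero_apply]; positivity),
      integral_Icc_eq_integral_Ioc, ← intervalIntegral.integral_of_le (by linarith)]
    congr 1
    have h2 : ∀ p : ℝ, 2 * √(K - p ^ 2) = 2 * R * √(1 - (p / R) ^ 2) := by
      intro p
      have : K - p ^ 2 = R ^ 2 * (1 - (p / R) ^ 2) := by
        field_simp; rw [hRK]
      rw [this, Real.sqrt_mul (sq_nonneg R), Real.sqrt_sq hR0.le]; ring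
    simp_rw [h2]
    rw [intervalIntegral.integral_const_mul]
    have h3 := intervalIntegral.integral_comp_div (f := fun x : ℝ => √(1 - x ^ 2))
      (a := -R) (b := R) hR0.ne'
    rw [h3, neg_div, div_self hR0.ne', integral_sqrt_one_sub_sq, smul_eq_mul, ← hRK]
    ring

/-- Disc area through two iterated Lebesgue integrals, with a constant factor:
`∫∫ C·𝟙[p² + q² ≤ K] = C·πK`. [folklore] -/
theorem lintegral_disc (C : ℝ≥0∞) (K : ℝ) :
    ∫⁻ p, ∫⁻ q, C * (if p ^ 2 + q ^ 2 ≤ K then (1 : ℝ≥0∞) else 0) =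
      C * ENNReal.ofReal (π * K) := by
  have h1 : ∀ p : ℝ, ∫⁻ q, C * (if p ^ 2 + q ^ 2 ≤ K then (1 : ℝ≥0∞) else 0) =
      C * ENNReal.ofReal (2 * √(K - p ^ 2)) := by
    intro p
    rw [lintegral_const_mul _ (Measurable.ite (measurableSet_le (by fun_prop) measurable_const)
      measurable_const measurable_const)]
    congr 1
    have : ∀ q : ℝ, (p ^ 2 + q ^ 2 ≤ K ↔ q ^ 2 ≤ K - p ^ 2) := fun q => by
      constructor <;> intro h <;> linarith
    simp_rw [this]
    exact lintegral_sq_le (K - p ^ 2)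
  simp_rw [h1]
  rw [lintegral_const_mul _ (Measurable.ennreal_ofReal (by fun_prop)), lintegral_sqrt_sub_sq]

/-- Variant of `lintegral_disc` with a trailing constant factor. [folklore] -/
theorem lintegral_disc' (C E : ℝ≥0∞) (K : ℝ) :
    ∫⁻ p, ∫⁻ q, C * (if p ^ 2 + q ^ 2 ≤ K then (1 : ℝ≥0∞) else 0) * E =
      C * E * ENNReal.ofReal (π * K) := by
  simp_rw [mul_right_comm C _ E]
  exact lintegral_disc (C * E) K

/-- A nonnegative continuous integrand cut to `[lo, hi]`: Lebesgue = interval integral.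
[folklore] -/
theorem lintegral_ite_Icc {lo hi : ℝ} {h : ℝ → ℝ} (hle : lo ≤ hi) (hc : Continuous h)
    (h0 : ∀ x ∈ Icc lo hi, 0 ≤ h x) :
    ∫⁻ x, (if lo ≤ x ∧ x ≤ hi then ENNReal.ofReal (h x) else 0) =
      ENNReal.ofReal (∫ x in lo..hi, h x) := by
  have hfun : (fun x => if lo ≤ x ∧ x ≤ hi then ENNReal.ofReal (h x) else 0) =
      (Icc lo hi).indicator (fun x => ENNReal.ofReal (h x)) := by
    funext x; simp only [Set.indicator_apply, Set.mem_Icc]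
  rw [hfun, lintegral_indicator measurableSet_Icc, intervalIntegral.integral_of_le hle,
    ← integral_Icc_eq_integral_Ioc, ofReal_integral_eq_lintegral_ofReal hc.integrableOn_Icc]
  filter_upwards [ae_restrict_mem measurableSet_Icc] with x hx using h0 x hx

/-- `∫₀^τ π(bc)·π(a(τ−c)) dc = π² ab τ³/6`. [folklore] -/
theorem integral_layerC_X (a b : ℝ) :
    ∫ c in (0 : ℝ)..(1 - a - b), π * (b * c) * (π * (a * (1 - a - b - c))) =
      π ^ 2 * (a * b * (1 - a - b) ^ 3 / 6) := by
  have : ∀ c : ℝ, π * (b * c) * (π * (a * (1 - a - b - c))) =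
      π ^ 2 * a * b * (1 - a - b) * c ^ 1 - π ^ 2 * a * b * c ^ 2 := by intro c; ring
  simp_rw [this]
  rw [intervalIntegral.integral_sub (Continuous.intervalIntegrable (by fun_prop) _ _)
      (Continuous.intervalIntegrable (by fun_prop) _ _),
    intervalIntegral.integral_const_mul, intervalIntegral.integral_const_mul,
    integral_pow, integral_pow]
  ring

/-- `∫₀^{1−a} π² ab(1−a−b)³/6 db = π² a(1−a)⁵/120`. [folklore] -/
theorem integral_layerB_X (a : ℝ) :
    ∫ b in (0 : ℝ)..(1 - a), π ^ 2 * (a * b * (1 - a - b) ^ 3 / 6) =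
      π ^ 2 * (a * (1 - a) ^ 5 / 120) := by
  have h := intervalIntegral.integral_comp_sub_left
    (fun x : ℝ => π ^ 2 * (a * ((1 - a) - x) * x ^ 3 / 6)) (a := 0) (b := 1 - a) (1 - a)
  simp only [sub_sub_cancel, sub_self, sub_zero] at h
  rw [h]
  have : ∀ x : ℝ, π ^ 2 * (a * (1 - a - x) * x ^ 3 / 6) =
      π ^ 2 * a * (1 - a) / 6 * x ^ 3 - π ^ 2 * a / 6 * x ^ 4 := by intro x; ring
  simp_rw [this]
  rw [intervalIntegral.integral_sub (Continuous.intervalIntegrable (by fun_prop) _ _)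
      (Continuous.intervalIntegrable (by fun_prop) _ _),
    intervalIntegral.integral_const_mul, intervalIntegral.integral_const_mul,
    integral_pow, integral_pow]
  ring

/-- `∫₀¹ π² a(1−a)⁵/120 da = π²/5040`. [folklore] -/
theorem integral_layerA_X :
    ∫ a in (0 : ℝ)..1, π ^ 2 * (a * (1 - a) ^ 5 / 120) = π ^ 2 / 5040 := by
  have h := intervalIntegral.integral_comp_sub_left
    (fun x : ℝ => π ^ 2 * ((1 - x) * x ^ 5 / 120)) (a := 0) (b := 1) 1
  simp only [sub_sub_cancel, sub_self, sub_zero] at h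
  rw [h]
  have : ∀ x : ℝ, π ^ 2 * ((1 - x) * x ^ 5 / 120) =
      π ^ 2 / 120 * x ^ 5 - π ^ 2 / 120 * x ^ 6 := by intro x; ring
  simp_rw [this]
  rw [intervalIntegral.integral_sub (Continuous.intervalIntegrable (by fun_prop) _ _)
      (Continuous.intervalIntegrable (by fun_prop) _ _),
    intervalIntegral.integral_const_mul, intervalIntegral.integral_const_mul,
    integral_pow, integral_pow]
  ring

/-- `∫₀^σ a²(σ−a)² da = σ⁵/30`, with the constant of the PPT layer. [folklore] -/
theorem integral_layerA_P (σ : ℝ) :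
    ∫ a in (0 : ℝ)..σ, π ^ 2 * ((1 - σ) ^ 3 * a ^ 2 * (σ - a) ^ 2 / (3 * σ ^ 2)) =
      π ^ 2 * ((1 - σ) ^ 3 * σ ^ 5 / (90 * σ ^ 2)) := by
  have : ∀ a : ℝ, π ^ 2 * ((1 - σ) ^ 3 * a ^ 2 * (σ - a) ^ 2 / (3 * σ ^ 2)) =
      π ^ 2 * (1 - σ) ^ 3 / (3 * σ ^ 2) * σ ^ 2 * a ^ 2
        - π ^ 2 * (1 - σ) ^ 3 / (3 * σ ^ 2) * (2 * σ) * a ^ 3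
        + π ^ 2 * (1 - σ) ^ 3 / (3 * σ ^ 2) * a ^ 4 := by intro a; ring
  simp_rw [this]
  rw [intervalIntegral.integral_add (Continuous.intervalIntegrable (by fun_prop) _ _)
      (Continuous.intervalIntegrable (by fun_prop) _ _),
    intervalIntegral.integral_sub (Continuous.intervalIntegrable (by fun_prop) _ _)
      (Continuous.intervalIntegrable (by fun_prop) _ _),
    intervalIntegral.integral_const_mul, intervalIntegral.integral_const_mul,
    intervalIntegral.integral_const_mul, integral_pow, integral_pow, integral_pow]
  ring

/-- `∫₀¹ π²(1−σ)³σ³/90 dσ = π²/12600`. [folklore] -/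
theorem integral_layerS_P :
    ∫ σ in (0 : ℝ)..1, π ^ 2 * ((1 - σ) ^ 3 * σ ^ 3 / 90) = π ^ 2 / 12600 := by
  have : ∀ σ : ℝ, π ^ 2 * ((1 - σ) ^ 3 * σ ^ 3 / 90) =
      π ^ 2 / 90 * σ ^ 3 - 3 * π ^ 2 / 90 * σ ^ 4 + 3 * π ^ 2 / 90 * σ ^ 5
        - π ^ 2 / 90 * σ ^ 6 := by intro σ; ring
  simp_rw [this]
  rw [intervalIntegral.integral_sub (Continuous.intervalIntegrable (by fun_prop) _ _)
      (Continuous.intervalIntegrable (by fun_prop) _ _),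
    intervalIntegral.integral_add (Continuous.intervalIntegrable (by fun_prop) _ _)
      (Continuous.intervalIntegrable (by fun_prop) _ _),
    intervalIntegral.integral_sub (Continuous.intervalIntegrable (by fun_prop) _ _)
      (Continuous.intervalIntegrable (by fun_prop) _ _),
    intervalIntegral.integral_const_mul, intervalIntegral.integral_const_mul,
    intervalIntegral.integral_const_mul, intervalIntegral.integral_const_mul,
    integral_pow, integral_pow, integral_pow, integral_pow]
  ring

/-! ### The layers (innermost first) -/

/-- The inner `c`-integral of the PPT body (Milz–Strunz App. B, `∫∫ min(r², R²)²`, in the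
entry chart): `∫₀^τ (π·min(a(τ−c), bc))² dc = π² τ³a²b²/(3(a+b)²)`, `τ = 1 − a − b`; the two
branches of the `min` switch at `c = aτ/(a+b)` ("`r² < R² ⇔ Z < z`"). [folklore] -/
theorem integral_layerC_P {a b : ℝ} (ha : 0 ≤ a) (hb : 0 ≤ b) (hab : a + b ≤ 1) :
    ∫ c in (0 : ℝ)..(1 - a - b), π * min (a * (1 - a - b - c)) (b * c) *
        (π * min (a * (1 - a - b - c)) (b * c)) =
      π ^ 2 * ((1 - a - b) ^ 3 * a ^ 2 * b ^ 2 / (3 * (a + b) ^ 2)) := by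
  set τ := 1 - a - b with hτ
  have hτ0 : 0 ≤ τ := by rw [hτ]; linarith
  rcases eq_or_lt_of_le (add_nonneg ha hb) with hab0 | hab0
  · have ha0 : a = 0 := by linarith
    have hb0 : b = 0 := by linarith
    subst ha0; subst hb0; simp
  · set cs := a * τ / (a + b) with hcs
    have hcs0 : 0 ≤ cs := div_nonneg (mul_nonneg ha hτ0) hab0.le
    have hcsτ : cs ≤ τ := by rw [hcs, div_le_iff₀ hab0]; nlinarith
    rw [← intervalIntegral.integral_add_adjacent_intervals (b := cs)
      (Continuous.intervalIntegrable (by fun_prop) _ _)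
      (Continuous.intervalIntegrable (by fun_prop) _ _)]
    have left : ∫ c in (0 : ℝ)..cs, π * min (a * (τ - c)) (b * c) *
        (π * min (a * (τ - c)) (b * c)) =
        ∫ c in (0 : ℝ)..cs, π ^ 2 * b ^ 2 * c ^ 2 := by
      apply intervalIntegral.integral_congr
      intro c hc
      rw [Set.uIcc_of_le hcs0, Set.mem_Icc] at hc
      have hmin : min (a * (τ - c)) (b * c) = b * c := min_eq_right (by
        have h2 := hc.2; rw [hcs, le_div_iff₀ hab0] at h2; nlinarith)
      simp only [hmin]; ring
    have right : ∫ c in cs..τ, π * min (a * (τ - c)) (b * c) * (π * min (a * (τ - c)) (b * c)) =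
        ∫ c in cs..τ, π ^ 2 * a ^ 2 * (τ - c) ^ 2 := by
      apply intervalIntegral.integral_congr
      intro c hc
      rw [Set.uIcc_of_le hcsτ, Set.mem_Icc] at hc
      have hmin : min (a * (τ - c)) (b * c) = a * (τ - c) := min_eq_left (by
        have h1 := hc.1; rw [hcs, div_le_iff₀ hab0] at h1; nlinarith)
      simp only [hmin]; ring
    rw [left, right, intervalIntegral.integral_const_mul, integral_pow]
    have h := intervalIntegral.integral_comp_sub_left (fun x : ℝ => π ^ 2 * a ^ 2 * x ^ 2)
      (a := cs) (b := τ) τ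
    rw [h, sub_self, intervalIntegral.integral_const_mul, integral_pow]
    have hab' : a + b ≠ 0 := hab0.ne'
    have hτcs : τ - cs = b * τ / (a + b) := by
      rw [hcs, eq_div_iff hab', sub_mul, div_mul_cancel₀ _ hab']; ring
    rw [hτcs, hcs]
    norm_num
    rw [div_pow, div_pow]
    field_simp

/-- `c`-layer of the X-body: `∫ 𝟙_Δ · π(bc) · π(ad) dc = 𝟙 · π² ab(1−a−b)³/6`. [folklore] -/
theorem layerC_X (a b : ℝ) :
    ∫⁻ c, (if 0 ≤ a ∧ 0 ≤ b ∧ 0 ≤ c ∧ 0 ≤ 1 - a - b - c then (1 : ℝ≥0∞) else 0) *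
        ENNReal.ofReal (π * (b * c)) * ENNReal.ofReal (π * (a * (1 - a - b - c))) =
      if 0 ≤ a ∧ 0 ≤ b ∧ a + b ≤ 1 then
        ENNReal.ofReal (π ^ 2 * (a * b * (1 - a - b) ^ 3 / 6)) else 0 := by
  by_cases H : 0 ≤ a ∧ 0 ≤ b ∧ a + b ≤ 1
  · obtain ⟨ha, hb, hab⟩ := H
    have hpt : ∀ c : ℝ, (if 0 ≤ a ∧ 0 ≤ b ∧ 0 ≤ c ∧ 0 ≤ 1 - a - b - c then (1 : ℝ≥0∞) else 0) *
        ENNReal.ofReal (π * (b * c)) * ENNReal.ofReal (π * (a * (1 - a - b - c))) =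
        if 0 ≤ c ∧ c ≤ 1 - a - b then
          ENNReal.ofReal (π * (b * c) * (π * (a * (1 - a - b - c)))) else 0 := by
      intro c
      by_cases hc : 0 ≤ c ∧ c ≤ 1 - a - b
      · rw [if_pos hc, if_pos ⟨ha, hb, hc.1, by linarith [hc.2]⟩, one_mul,
          ← ENNReal.ofReal_mul (mul_nonneg pi_pos.le (mul_nonneg hb hc.1))]
      · rw [if_neg hc, if_neg (fun h => hc ⟨h.2.2.1, by linarith [h.2.2.2]⟩), zero_mul, zero_mul]
    simp_rw [hpt]
    rw [lintegral_ite_Icc (by linarith) (by fun_prop) (fun c hc => mul_nonneg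
        (mul_nonneg pi_pos.le (mul_nonneg hb hc.1))
        (mul_nonneg pi_pos.le (mul_nonneg ha (by linarith [hc.2])))),
      integral_layerC_X, if_pos ⟨ha, hb, hab⟩]
  · rw [if_neg H]
    have hpt : ∀ c : ℝ, (if 0 ≤ a ∧ 0 ≤ b ∧ 0 ≤ c ∧ 0 ≤ 1 - a - b - c then (1 : ℝ≥0∞) else 0) *
        ENNReal.ofReal (π * (b * c)) * ENNReal.ofReal (π * (a * (1 - a - b - c))) = 0 := by
      intro c
      rw [if_neg (fun h => H ⟨h.1, h.2.1, by linarith [h.2.2.1, h.2.2.2]⟩), zero_mul, zero_mul]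
    simp_rw [hpt]
    exact lintegral_zero

/-- `c`-layer of the PPT body: `∫ 𝟙_Δ · (π m)² dc = 𝟙 · π² (1−a−b)³a²b²/(3(a+b)²)`,
`m = min(ad, bc)`. [folklore] -/
theorem layerC_P (a b : ℝ) :
    ∫⁻ c, (if 0 ≤ a ∧ 0 ≤ b ∧ 0 ≤ c ∧ 0 ≤ 1 - a - b - c then (1 : ℝ≥0∞) else 0) *
        ENNReal.ofReal (π * min (a * (1 - a - b - c)) (b * c)) *
        ENNReal.ofReal (π * min (a * (1 - a - b - c)) (b * c)) =
      if 0 ≤ a ∧ 0 ≤ b ∧ a + b ≤ 1 then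
        ENNReal.ofReal (π ^ 2 * ((1 - a - b) ^ 3 * a ^ 2 * b ^ 2 / (3 * (a + b) ^ 2))) else 0 := by
  by_cases H : 0 ≤ a ∧ 0 ≤ b ∧ a + b ≤ 1
  · obtain ⟨ha, hb, hab⟩ := H
    have hm : ∀ c ∈ Icc 0 (1 - a - b), 0 ≤ π * min (a * (1 - a - b - c)) (b * c) := fun c hc =>
      mul_nonneg pi_pos.le (le_min (mul_nonneg ha (by linarith [hc.2])) (mul_nonneg hb hc.1))
    have hpt : ∀ c : ℝ, (if 0 ≤ a ∧ 0 ≤ b ∧ 0 ≤ c ∧ 0 ≤ 1 - a - b - c then (1 : ℝ≥0∞) else 0) *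
        ENNReal.ofReal (π * min (a * (1 - a - b - c)) (b * c)) *
        ENNReal.ofReal (π * min (a * (1 - a - b - c)) (b * c)) =
        if 0 ≤ c ∧ c ≤ 1 - a - b then
          ENNReal.ofReal (π * min (a * (1 - a - b - c)) (b * c) *
            (π * min (a * (1 - a - b - c)) (b * c))) else 0 := by
      intro c
      by_cases hc : 0 ≤ c ∧ c ≤ 1 - a - b
      · rw [if_pos hc, if_pos ⟨ha, hb, hc.1, by linarith [hc.2]⟩, one_mul,
          ← ENNReal.ofReal_mul (hm c hc)]
      · rw [if_neg hc, if_neg (fun h => hc ⟨h.2.2.1, by linarith [h.2.2.2]⟩), zero_mul, zero_mul]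
    simp_rw [hpt]
    rw [lintegral_ite_Icc (by linarith) (by fun_prop) (fun c hc => mul_nonneg (hm c hc) (hm c hc)),
      integral_layerC_P ha hb hab, if_pos ⟨ha, hb, hab⟩]
  · rw [if_neg H]
    have hpt : ∀ c : ℝ, (if 0 ≤ a ∧ 0 ≤ b ∧ 0 ≤ c ∧ 0 ≤ 1 - a - b - c then (1 : ℝ≥0∞) else 0) *
        ENNReal.ofReal (π * min (a * (1 - a - b - c)) (b * c)) *
        ENNReal.ofReal (π * min (a * (1 - a - b - c)) (b * c)) = 0 := by
      intro c
      rw [if_neg (fun h => H ⟨h.1, h.2.1, by linarith [h.2.2.1, h.2.2.2]⟩), zero_mul, zero_mul]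
    simp_rw [hpt]
    exact lintegral_zero

/-- `b`-layer of the X-body. [folklore] -/
theorem layerB_X (a : ℝ) :
    ∫⁻ b, (if 0 ≤ a ∧ 0 ≤ b ∧ a + b ≤ 1 then
        ENNReal.ofReal (π ^ 2 * (a * b * (1 - a - b) ^ 3 / 6)) else 0) =
      if 0 ≤ a ∧ a ≤ 1 then ENNReal.ofReal (π ^ 2 * (a * (1 - a) ^ 5 / 120)) else 0 := by
  by_cases H : 0 ≤ a ∧ a ≤ 1
  · obtain ⟨ha, ha1⟩ := H
    have hpt : ∀ b : ℝ, (if 0 ≤ a ∧ 0 ≤ b ∧ a + b ≤ 1 then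
        ENNReal.ofReal (π ^ 2 * (a * b * (1 - a - b) ^ 3 / 6)) else 0) =
        if 0 ≤ b ∧ b ≤ 1 - a then ENNReal.ofReal (π ^ 2 * (a * b * (1 - a - b) ^ 3 / 6)) else 0 :=
      fun b => if_congr ⟨fun h => ⟨h.2.1, by linarith [h.2.2]⟩,
        fun h => ⟨ha, h.1, by linarith [h.2]⟩⟩ rfl rfl
    simp_rw [hpt]
    rw [lintegral_ite_Icc (by linarith) (by fun_prop) (fun b hb => by
        have h1 : 0 ≤ b := hb.1
        have h2 : 0 ≤ 1 - a - b := by linarith [hb.2]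
        positivity), integral_layerB_X, if_pos ⟨ha, ha1⟩]
  · rw [if_neg H]
    have hpt : ∀ b : ℝ, (if 0 ≤ a ∧ 0 ≤ b ∧ a + b ≤ 1 then
        ENNReal.ofReal (π ^ 2 * (a * b * (1 - a - b) ^ 3 / 6)) else 0) = 0 := fun b =>
      if_neg (fun h => H ⟨h.1, by linarith [h.2.1, h.2.2]⟩)
    simp_rw [hpt]
    exact lintegral_zero

/-- `a`-layer of the X-body: `∫_Δ π² abcd = π²/5040` (Milz–Strunz: `V_HS^{(X)} = π²/5040`).
[folklore] -/
theorem layerA_X :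
    ∫⁻ a, (if 0 ≤ a ∧ a ≤ 1 then ENNReal.ofReal (π ^ 2 * (a * (1 - a) ^ 5 / 120)) else 0) =
      ENNReal.ofReal (π ^ 2 / 5040) := by
  rw [lintegral_ite_Icc zero_le_one (by fun_prop) (fun a ha => by
      have h1 : 0 ≤ a := ha.1
      have h2 : 0 ≤ 1 - a := by linarith [ha.2]
      positivity), integral_layerA_X]

/-- `a`-layer of the PPT body at fixed `σ = a + b`. [folklore] -/
theorem layerA_P (σ : ℝ) :
    ∫⁻ a, (if 0 ≤ a ∧ a ≤ σ ∧ σ ≤ 1 then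
        ENNReal.ofReal (π ^ 2 * ((1 - σ) ^ 3 * a ^ 2 * (σ - a) ^ 2 / (3 * σ ^ 2))) else 0) =
      if 0 ≤ σ ∧ σ ≤ 1 then ENNReal.ofReal (π ^ 2 * ((1 - σ) ^ 3 * σ ^ 3 / 90)) else 0 := by
  by_cases H : 0 ≤ σ ∧ σ ≤ 1
  · obtain ⟨hσ0, hσ1⟩ := H
    rw [if_pos ⟨hσ0, hσ1⟩]
    rcases eq_or_lt_of_le hσ0 with hσ | hσ
    · subst hσ
      have hpt : ∀ a : ℝ, (if 0 ≤ a ∧ a ≤ 0 ∧ (0 : ℝ) ≤ 1 then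
          ENNReal.ofReal (π ^ 2 * ((1 - 0) ^ 3 * a ^ 2 * (0 - a) ^ 2 / (3 * 0 ^ 2))) else 0) =
          0 := by
        intro a; split_ifs <;> simp
      simp_rw [hpt, lintegral_zero]
      simp
    · have hpt : ∀ a : ℝ, (if 0 ≤ a ∧ a ≤ σ ∧ σ ≤ 1 then
          ENNReal.ofReal (π ^ 2 * ((1 - σ) ^ 3 * a ^ 2 * (σ - a) ^ 2 / (3 * σ ^ 2))) else 0) =
          if 0 ≤ a ∧ a ≤ σ then
            ENNReal.ofReal (π ^ 2 * ((1 - σ) ^ 3 * a ^ 2 * (σ - a) ^ 2 / (3 * σ ^ 2))) else 0 :=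
        fun a => if_congr ⟨fun h => ⟨h.1, h.2.1⟩, fun h => ⟨h.1, h.2, hσ1⟩⟩ rfl rfl
      simp_rw [hpt]
      rw [lintegral_ite_Icc hσ0 (by fun_prop) (fun a ha => by
          have h2 : 0 ≤ 1 - σ := by linarith
          positivity), integral_layerA_P]
      have e : π ^ 2 * ((1 - σ) ^ 3 * σ ^ 5 / (90 * σ ^ 2)) =
          π ^ 2 * ((1 - σ) ^ 3 * σ ^ 3 / 90) := by
        congr 1
        rw [div_eq_div_iff (by positivity) (by norm_num)]
        ring
      rw [e]
  · rw [if_neg H]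
    have hpt : ∀ a : ℝ, (if 0 ≤ a ∧ a ≤ σ ∧ σ ≤ 1 then
        ENNReal.ofReal (π ^ 2 * ((1 - σ) ^ 3 * a ^ 2 * (σ - a) ^ 2 / (3 * σ ^ 2))) else 0) = 0 :=
      fun a => if_neg (fun h => H ⟨h.1.trans h.2.1, h.2.2⟩)
    simp_rw [hpt]
    exact lintegral_zero

/-- `(a, b)`-layers of the PPT body: shear `b = σ − a`, Tonelli, then the two Beta integrals
(Milz–Strunz conditioning on the reduced state, `a + b = (1 + a₃)/2`). [folklore] -/
theorem layerAB_P :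
    ∫⁻ a, ∫⁻ b, (if 0 ≤ a ∧ 0 ≤ b ∧ a + b ≤ 1 then
        ENNReal.ofReal (π ^ 2 * ((1 - a - b) ^ 3 * a ^ 2 * b ^ 2 / (3 * (a + b) ^ 2))) else 0) =
      ENNReal.ofReal (π ^ 2 / 12600) := by
  have hG : Measurable (fun p : ℝ × ℝ => if 0 ≤ p.1 ∧ p.1 ≤ p.2 ∧ p.2 ≤ 1 then
      ENNReal.ofReal (π ^ 2 * ((1 - p.2) ^ 3 * p.1 ^ 2 * (p.2 - p.1) ^ 2 / (3 * p.2 ^ 2)))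
      else 0) := by
    refine Measurable.ite ?_ (Measurable.ennreal_ofReal (by fun_prop)) measurable_const
    exact (measurableSet_le measurable_const measurable_fst).inter
      ((measurableSet_le measurable_fst measurable_snd).inter
        (measurableSet_le measurable_snd measurable_const))
  calc ∫⁻ a, ∫⁻ b, (if 0 ≤ a ∧ 0 ≤ b ∧ a + b ≤ 1 then
        ENNReal.ofReal (π ^ 2 * ((1 - a - b) ^ 3 * a ^ 2 * b ^ 2 / (3 * (a + b) ^ 2))) else 0)
      = ∫⁻ a, ∫⁻ σ, (if 0 ≤ a ∧ a ≤ σ ∧ σ ≤ 1 then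
          ENNReal.ofReal (π ^ 2 * ((1 - σ) ^ 3 * a ^ 2 * (σ - a) ^ 2 / (3 * σ ^ 2))) else 0) := by
        refine lintegral_congr fun a => ?_
        rw [← lintegral_sub_right_eq_self (μ := volume) (fun b : ℝ =>
          (if 0 ≤ a ∧ 0 ≤ b ∧ a + b ≤ 1 then
            ENNReal.ofReal (π ^ 2 * ((1 - a - b) ^ 3 * a ^ 2 * b ^ 2 / (3 * (a + b) ^ 2)))
          else 0)) a]
        refine lintegral_congr fun σ => ?_
        have e1 : 1 - a - (σ - a) = 1 - σ := by ring
        have e2 : a + (σ - a) = σ := by ring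
        simp only [e1, e2, sub_nonneg]
    _ = ∫⁻ σ, ∫⁻ a, (if 0 ≤ a ∧ a ≤ σ ∧ σ ≤ 1 then
          ENNReal.ofReal (π ^ 2 * ((1 - σ) ^ 3 * a ^ 2 * (σ - a) ^ 2 / (3 * σ ^ 2))) else 0) :=
        lintegral_lintegral_swap hG.aemeasurable
    _ = ∫⁻ σ, (if 0 ≤ σ ∧ σ ≤ 1 then ENNReal.ofReal (π ^ 2 * ((1 - σ) ^ 3 * σ ^ 3 / 90)) else 0) :=
        lintegral_congr fun σ => layerA_P σ
    _ = ENNReal.ofReal (π ^ 2 / 12600) := by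
        rw [lintegral_ite_Icc zero_le_one (by fun_prop) (fun σ hσ => by
          have h1 : 0 ≤ σ := hσ.1
          have h2 : 0 ≤ 1 - σ := by linarith [hσ.2]
          positivity), integral_layerS_P]

end MilzStrunzXStates

open MilzStrunzXStates

/-! ### Assembly -/

/-- The X-body is measurable (a finite intersection of closed polynomial conditions).
[folklore] -/
theorem measurableSet_xStateBody : MeasurableSet xStateBody := by
  unfold xStateBody; measurability

/-- The PPT X-body is measurable. [folklore] -/
theorem measurableSet_xStatePPTBody : MeasurableSet xStatePPTBody := by
  unfold xStatePPTBody; measurability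

/-- **Milz–Strunz, volume of the X-states** in the entry chart: `vol₇(X-states) = π² ∫_Δ abcd =
π²/5040` (the printed `V^{(X)}_{HS} = π²/5040`, §5, whose HS normalisation happens to agree
with the entry chart). [cite: MilzStrunz2014, §5 eq. (V^(X)_HS) and App. A] -/
theorem volume_xStateBody : volume xStateBody = ENNReal.ofReal (π ^ 2 / 5040) := by
  rw [volume_eq_lintegral7 measurableSet_xStateBody]
  simp_rw [indicator_xStateBody, lintegral_disc, lintegral_disc', layerC_X, layerB_X]
  exact layerA_X

/-- **Milz–Strunz App. B in the entry chart**: `vol₇(PPT X-states) = π² ∫_Δ min(ad, bc)² =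
π²/12600`. [cite: MilzStrunz2014, App. B eq. (V_euclid,sep^(X))] -/
theorem volume_xStatePPTBody : volume xStatePPTBody = ENNReal.ofReal (π ^ 2 / 12600) := by
  rw [volume_eq_lintegral7 measurableSet_xStatePPTBody]
  simp_rw [indicator_xStatePPTBody, lintegral_disc, lintegral_disc', layerC_P]
  exact layerAB_P

/-- **Milz–Strunz 2015, §5 with Appendices A–B: `p_sep^{(X)} = 2/5`** — the named fact
`MilzStrunz2014_xState_separability_probability` discharged:
`5 · vol₇(PPT X-states) = 2 · vol₇(X-states)` (`5 · π²/12600 = π²/2520 = 2 · π²/5040`).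
[cite: MilzStrunz2014, §5 (p_sep^(X)(r) = 2/5) with App. A–B] -/
theorem MilzStrunz2014_xState_separability_probability_holds :
    MilzStrunz2014_xState_separability_probability := by
  unfold MilzStrunz2014_xState_separability_probability
  rw [volume_xStatePPTBody, volume_xStateBody, ← ENNReal.ofReal_ofNat 5,
    ← ENNReal.ofReal_ofNat 2, ← ENNReal.ofReal_mul (by norm_num),
    ← ENNReal.ofReal_mul (by norm_num)]
  congr 1
  ring

end Literature.Probability.RandomMatrix

end
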